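import Mathlib
import Literature.Analysis.Calculus.UniformC1Composition
import HarnessLib

/-!
# A `C¹`-small perturbation of the axis `z ↦ (z, 0)` is a graph over a fixed disc

Let `h n : ℂ → ℂ × ℂ` converge to the axis embedding `z ↦ (z, 0)` in `C¹` on a closed disc
`B̄(z₁, ρ)` (values and derivatives uniformly). Then for `n` large the image of `h n` contains the
GRAPH of a continuous, uniformly small function `g` over the fixed smaller disc `B̄(z₁, ρ/8)`:
every `α` in that disc is the first coordinate of some `h n ζ`, `ζ ∈ B(z₁, ρ)`, with second
coordinate `g α` (`eventually_exists_graph`). Proof: the first coordinate `a = (h n).1` is a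
`C¹`-perturbation of the identity (`‖da - id‖ ≤ 1/2` eventually), hence injective on `B(z₁, ρ/2)`
with a continuous right inverse `φ` on `B̄(a z₁, ρ/8) ⊇ B̄(z₁, ρ/16)`
(`Literature.Analysis.Calculus.exists_rightInverse_of_approximatesLinearOn_id`); put
`g := (h n).2 ∘ φ`. This is the reparametrisation step of McDuff's `C¹`-perturbation argument
(McDuff (1991), Lemma 4.3) in the sheet-chart coordinates of
`Literature/Geometry/Symplectic/JHolomorphicSheetChart.lean`.

* `eventually_exists_graph`.

## References

* D. McDuff, *The local behaviour of holomorphic curves in almost complex 4-manifolds*,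
  J. Differential Geom. 34 (1991), Lemma 4.3. [McDuff1991LocalBehaviour]
-/

noncomputable section

open scoped Topology NNReal
open Set Function Metric Filter

namespace Literature.Analysis.Calculus

/-- `‖fst ∘ (L - inl)‖ ≤ ‖L - inl‖` and `fst ∘ inl = id`: the first coordinate of a perturbation of
the axis embedding is a perturbation of the identity of the same size. [folklore] -/
theorem norm_fst_comp_sub_id_le (L : ℂ →L[ℝ] ℂ × ℂ) :
    ‖(ContinuousLinearMap.fst ℝ ℂ ℂ).comp L - ContinuousLinearMap.id ℝ ℂ‖ ≤
      ‖L - ContinuousLinearMap.inl ℝ ℂ ℂ‖ := by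
  have e : (ContinuousLinearMap.fst ℝ ℂ ℂ).comp L - ContinuousLinearMap.id ℝ ℂ =
      (ContinuousLinearMap.fst ℝ ℂ ℂ).comp (L - ContinuousLinearMap.inl ℝ ℂ ℂ) := by
    ext w
    simp
  rw [e]
  refine (ContinuousLinearMap.opNorm_comp_le _ _).trans ?_
  calc ‖ContinuousLinearMap.fst ℝ ℂ ℂ‖ * ‖L - ContinuousLinearMap.inl ℝ ℂ ℂ‖
      ≤ 1 * ‖L - ContinuousLinearMap.inl ℝ ℂ ℂ‖ := by
        gcongr; exact ContinuousLinearMap.norm_fst_le ℝ ℂ ℂ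
    _ = _ := one_mul _

/-- **A `C¹`-small perturbation of the axis is a graph over a fixed disc.** Let
`h n → (z ↦ (z, 0))` and `fderiv (h n) → inl` uniformly on `B̄(z₁, ρ)`, the `h n` being eventually
differentiable there. Then for every `η > 0`, eventually there is `g : ℂ → ℂ`, continuous on
`B̄(z₁, ρ/16)`, with `‖g α‖ < η` and `(α, g α) = h n ζ` for some `ζ ∈ B(z₁, ρ)`, for every `α` in
that disc. [cite: McDuff1991LocalBehaviour, Lemma 4.3 (reparametrisation step)] -/
theorem eventually_exists_graph {h : ℕ → ℂ → ℂ × ℂ} {z₁ : ℂ} {ρ : ℝ} (hρ : 0 < ρ)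
    (h0 : TendstoUniformlyOn h (fun z => ((z, 0) : ℂ × ℂ)) atTop (closedBall z₁ ρ))
    (h1 : TendstoUniformlyOn (fun n z => fderiv ℝ (h n) z)
      (fun _ => ContinuousLinearMap.inl ℝ ℂ ℂ) atTop (closedBall z₁ ρ))
    (hd : ∀ᶠ n in atTop, ∀ z ∈ closedBall z₁ ρ, DifferentiableAt ℝ (h n) z)
    {η : ℝ} (hη : 0 < η) :
    ∀ᶠ n in atTop, ∃ g : ℂ → ℂ, ContinuousOn g (closedBall z₁ (ρ / 16)) ∧
      ∀ α ∈ closedBall z₁ (ρ / 16), ‖g α‖ < η ∧ ∃ ζ ∈ ball z₁ ρ, h n ζ = (α, g α) := by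
  have hε : 0 < min η (ρ / 16) := lt_min hη (by linarith)
  filter_upwards [Metric.tendstoUniformlyOn_iff.1 h0 _ hε,
    Metric.tendstoUniformlyOn_iff.1 h1 (1 / 2) one_half_pos, hd] with n hn0 hn1 hnd
  -- the first coordinate `a` approximates the identity on `B(z₁, ρ/2)`
  set a : ℂ → ℂ := fun z => (h n z).1 with ha_def
  have hsub : ball z₁ (ρ / 2) ⊆ closedBall z₁ ρ := ball_subset_closedBall.trans
    (closedBall_subset_closedBall (by linarith))
  have had : ∀ z ∈ ball z₁ (ρ / 2), DifferentiableAt ℝ a z := fun z hz =>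
    (hnd z (hsub hz)).fst
  have hda : ∀ z ∈ ball z₁ (ρ / 2), ‖fderiv ℝ a z - ContinuousLinearMap.id ℝ ℂ‖ ≤ (1 / 2 : ℝ≥0) := by
    intro z hz
    rw [ha_def, fderiv.fst (hnd z (hsub hz))]
    refine (norm_fst_comp_sub_id_le _).trans ?_
    have := hn1 z (hsub hz)
    rw [dist_eq_norm, norm_sub_rev] at this
    exact_mod_cast this.le
  have happ := approximatesLinearOn_id_of_norm_fderiv_sub_id_le (convex_ball z₁ (ρ / 2)) had hda
  obtain ⟨-, φ, hφc, hφ⟩ := exists_rightInverse_of_approximatesLinearOn_id (x := z₁)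
    (by linarith : 0 < ρ / 2) (by norm_num : (1 / 2 : ℝ≥0) < 1) happ
  -- the domain of `φ` contains the fixed disc `B̄(z₁, ρ/16)` (as `a z₁` is close to `z₁`)
  have hrad : ((1 : ℝ) - ((1 / 2 : ℝ≥0) : ℝ)) * (ρ / 2 / 2) = ρ / 8 := by push_cast; ring
  rw [hrad] at hφc hφ
  have haz₁ : ‖a z₁ - z₁‖ < ρ / 16 := by
    have := hn0 z₁ (mem_closedBall_self hρ.le)
    rw [dist_eq_norm, norm_sub_rev] at this
    exact (norm_fst_le (h n z₁ - (z₁, 0))).trans_lt (this.trans_le (min_le_right _ _))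
  have hD : closedBall z₁ (ρ / 16) ⊆ closedBall (a z₁) (ρ / 8) := fun α hα => by
    rw [mem_closedBall, dist_eq_norm] at hα ⊢
    calc ‖α - a z₁‖ = ‖(α - z₁) - (a z₁ - z₁)‖ := by ring_nf
      _ ≤ ‖α - z₁‖ + ‖a z₁ - z₁‖ := norm_sub_le _ _
      _ ≤ ρ / 8 := by linarith
  -- the graph function
  refine ⟨fun α => (h n (φ α)).2, ?_, fun α hα => ⟨?_, φ α, ?_, ?_⟩⟩
  · -- continuity: `h n` is continuous on `B(z₁, ρ/2)` (differentiable), `φ` maps into it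
    have hhc : ContinuousOn (h n) (ball z₁ (ρ / 2)) := fun z hz =>
      (hnd z (hsub hz)).continuousAt.continuousWithinAt
    exact continuous_snd.comp_continuousOn
      ((hhc.comp (hφc.mono hD)) fun α hα => (hφ α (hD hα)).1)
  · -- smallness: `‖(h n ζ).2‖ ≤ ‖h n ζ - (ζ, 0)‖ < η`
    have hζ := (hφ α (hD hα)).1
    have := hn0 (φ α) (hsub hζ)
    rw [dist_eq_norm, norm_sub_rev] at this
    have h2 : ‖(h n (φ α)).2‖ ≤ ‖h n (φ α) - (φ α, 0)‖ := by
      have := norm_snd_le (h n (φ α) - (φ α, 0))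
      rwa [Prod.snd_sub, sub_zero] at this
    exact h2.trans_lt (this.trans_le (min_le_left _ _))
  · exact ball_subset_ball (by linarith) (hφ α (hD hα)).1
  · exact Prod.ext (hφ α (hD hα)).2 rfl

end Literature.Analysis.Calculus

end
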